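import Literature.NumberTheory.Automorphic.ArchDiagonalTorus     -- ★-to-be D1′b (F0P3a-p06 (g9)): `circleDiagonal`, `archDiagTorus`, `exists_archDiagTorus_eq_of_coe_eq_diagonal`
import HarnessLib

/-!
# The centraliser of a regular element of the diagonal torus of `U(diag α)(L⁺ ⊗ ℝ)` is the torus (road D1′b₃; Rogawski 1990 §3.1, §8.4;
# Bröcker–tom Dieck IV (2.3)(i), (3.1): `Z(T) = T`)

Topic `NumberTheory/Automorphic`; namespace `Literature.NumberTheory.Automorphic.UnitaryGroup`.  THEOREMS ONLY (no `def`, no instance, no notation, no axiom,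
no `sorry`).  Cell `pub/hodgecm-mathlib`, ENGINE T1 (crux H413 = `stmt-HodgeConjecture-24833`); floor-1 preparation, count-neutral, under books rows #111 (S-d) ∕ #88
(ST-∞) (ROAD-Sd §2–§3: the Weil-form orbital measures `m = dν ∕ dt_γ` of the thirteen-conjunct system are quotients by Haar measures `t_γ` on the CENTRALISERS
`Z(γ)`; on the regular set of the compact torus these centralisers are all ONE group, the torus — so ONE Haar measure `dt = dθ` serves every `γ ∈ T_reg`, which is
what «Weyl-normalised against `dT`» in ROAD-Sd §1∕§2 presupposes); author F0P3a-p06 (g9), sequel of D1′b `ArchDiagonalTorus` (LEAD DESK WORD T6-66 (2)).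

WHAT IS PROVED.
* §1 (local, `GL_N(ℂ)`) `eq_diagonal_of_commute_circleDiagonal` — a complex matrix commuting with `diag(z)`, `z ∈ (S¹)^N` injective, is diagonal.
* §2 (CM field `L`, `G_∞ = U(diag α)(L⁺ ⊗ ℝ)`) `archDiagTorus_mul_comm` (the torus is commutative), `isCompact_range_archDiagTorus` (it is compact), and
  **`centralizer_archDiagTorus_eq_range`**: for `diag(α)` non-degenerate and `t(z)` REGULAR (pairwise-distinct coordinates at every complex place, ★
  `isRegularElt_archDiagTorus_iff`), `Subgroup.centralizer {t(z)} = (archDiagTorus L N α).range` — `Z_{G_∞}(γ) = T_∞` for every `γ ∈ T_reg`; with the corollary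
  `centralizer_archDiagTorus_eq_centralizer` (the centralisers of two regular torus elements COINCIDE).
HONEST LABEL: HC_CM is proved only modulo the printed citations until rung 0 closes; this file is linear algebra of a torus and pays nothing by itself.

## References
* [Rogawski1990] J. D. Rogawski, *Automorphic Representations of Unitary Groups in Three Variables*, Ann. of Math. Stud. 123 (1990): §3.1 p. 19 (regular semisimple
  elements: centraliser a maximal torus), §8.4 pp. 126–127 (the torus `T` of the limit formulas).
* [BrockerTomDieck1985] Th. Bröcker, T. tom Dieck, *Representations of Compact Lie Groups*, GTM 98 (1985), IV (2.3)(i) (`Z(T) = T`), IV (3.1) (the diagonal torus).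
* [BorelJacquet1979] A. Borel, H. Jacquet, *Automorphic forms and automorphic representations*, PSPM 33.1 (1979), §4.1 (`G_∞`).
-/

set_option autoImplicit false

noncomputable section

open NumberField NumberField.InfinitePlace NumberField.mixedEmbedding
open scoped Matrix MatrixGroups

namespace Literature.NumberTheory.Automorphic.UnitaryGroup

section LocalCentralizer

variable (N : ℕ)

/-- **A complex matrix commuting with `diag(z)`, `z ∈ (S¹)^N` with pairwise-distinct coordinates, is diagonal** (`M_{ij}(z_j − z_i) = 0`).
[cite: BrockerTomDieck1985, IV (2.3)(i), (3.1) (p0155, p0160)] -/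
theorem eq_diagonal_of_commute_circleDiagonal {z : Fin N → Circle} (hz : Function.Injective z) {M : Matrix (Fin N) (Fin N) ℂ}
    (hM : M * (circleDiagonal N z : GL (Fin N) ℂ) = (circleDiagonal N z : GL (Fin N) ℂ) * M) :
    M = Matrix.diagonal fun i => M i i := by
  ext i j
  by_cases hij : i = j
  · subst hij; rw [Matrix.diagonal_apply_eq]
  · rw [Matrix.diagonal_apply_ne _ hij]
    have h := congrFun (congrFun hM i) j
    rw [coe_circleDiagonal, Matrix.mul_diagonal, Matrix.diagonal_mul] at h
    -- `M i j * z j = z i * M i j` with `z i ≠ z j`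
    have hne : (z j : ℂ) ≠ z i := fun e => hij (hz (Circle.ext e)).symm
    have h2 : M i j * ((z j : ℂ) - z i) = 0 := by rw [mul_sub, h, mul_comm]; ring
    rcases mul_eq_zero.mp h2 with h3 | h3
    · exact h3
    · exact absurd (sub_eq_zero.mp h3) hne

end LocalCentralizer

section CMCentralizer

variable (L : Type) [Field L] [NumberField L] [IsCMField L] (N : ℕ) (α : Fin N → L)

/-- The torus is commutative: `t(z) t(z′) = t(z′) t(z)`. [cite: BrockerTomDieck1985, IV (3.1) (p0160)] -/
theorem archDiagTorus_mul_comm (z z' : {w : InfinitePlace L // IsComplex w} → Fin N → Circle) :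
    archDiagTorus L N α z * archDiagTorus L N α z' = archDiagTorus L N α z' * archDiagTorus L N α z := by
  rw [← map_mul, ← map_mul, mul_comm]

/-- The torus `T_∞ = range t` is compact (continuous image of `(S¹)^{W × N}`). [cite: BrockerTomDieck1985, IV (3.1) (p0160)] [cite: BorelJacquet1979, §4.1] -/
theorem isCompact_range_archDiagTorus :
    IsCompact (Set.range (archDiagTorus L N α)) :=
  isCompact_range (continuous_archDiagTorus L N α)

/-- **THE CENTRALISER OF A REGULAR TORUS ELEMENT IS THE TORUS**: for `t(z)` with pairwise-distinct coordinates at every complex place (i.e. `t(z)` regular, ★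
`isRegularElt_archDiagTorus_iff`) and `diag(α)` non-degenerate, `Z_{G_∞}(t(z)) = T_∞ = range t` — place by place a matrix commuting with `diag(z_w)` is diagonal
(§1), and diagonal elements of `U(diag α)(L⁺ ⊗ ℝ)` are torus elements (★ `exists_archDiagTorus_eq_of_coe_eq_diagonal`). [cite: Rogawski1990, §3.1 p. 19]
[cite: BrockerTomDieck1985, IV (2.3)(i) (p0155)] -/
theorem centralizer_archDiagTorus_eq_range (hα : ∀ i, α i ≠ 0) {z : {w : InfinitePlace L // IsComplex w} → Fin N → Circle}
    (hz : ∀ w, Function.Injective (z w)) :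
    Subgroup.centralizer ({archDiagTorus L N α z} : Set (arch (↥(maximalRealSubfield L)) L (IsCMField.complexConj L) N (Matrix.diagonal α))) =
      (archDiagTorus L N α).range := by
  ext g
  rw [Subgroup.mem_centralizer_singleton_iff, MonoidHom.mem_range]
  constructor
  · intro hg
    -- every place component of `g` commutes with `diag(z_w)`, hence is diagonal
    have hdiag : ((g : GL (Fin N) (mixedSpace L)) : Matrix (Fin N) (Fin N) (mixedSpace L)) =
        Matrix.diagonal fun i => ((g : GL (Fin N) (mixedSpace L)) : Matrix (Fin N) (Fin N) (mixedSpace L)) i i := by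
      refine Matrix.ext fun i j => mixedSpace_ext (↥(maximalRealSubfield L)) L (IsCMField.complexConj L)
        (IsCMField.complexConj_ne_one L) (complexConj_smul_infinitePlace L) fun w => ?_
      have hw := congrArg (fun x : arch (↥(maximalRealSubfield L)) L (IsCMField.complexConj L) N (Matrix.diagonal α) =>
        (((archAt (↥(maximalRealSubfield L)) L (IsCMField.complexConj L) N (Matrix.diagonal α) w
          (complexConj_smul_infinitePlace L w.1) (IsCMField.complexConj_ne_one L) x : archLocal L N (Matrix.diagonal α) w) :
            GL (Fin N) ℂ) : Matrix (Fin N) (Fin N) ℂ)) hg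
      simp only [map_mul, Subgroup.coe_mul, Units.val_mul, archAt_archDiagTorus] at hw
      have hM := eq_diagonal_of_commute_circleDiagonal N (hz w) hw
      have hMij := congrFun (congrFun hM i) j
      simp only [coe_archAt_apply] at hMij
      rw [hMij]
      by_cases hij : i = j
      · subst hij; simp
      · simp [Matrix.diagonal_apply_ne _ hij]
    obtain ⟨z', hz'⟩ := exists_archDiagTorus_eq_of_coe_eq_diagonal L N α hα g _ hdiag
    exact ⟨z', hz'⟩
  · rintro ⟨z', rfl⟩
    exact archDiagTorus_mul_comm L N α z' z

/-- **The centralisers of any two REGULAR torus elements coincide** (both are the torus) — so ONE Haar measure on `T_∞` serves as `t_γ` for every `γ ∈ T_reg`.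
[cite: Rogawski1990, §3.1 p. 19; §8.4 p. 126] -/
theorem centralizer_archDiagTorus_eq_centralizer (hα : ∀ i, α i ≠ 0) {z z' : {w : InfinitePlace L // IsComplex w} → Fin N → Circle}
    (hz : ∀ w, Function.Injective (z w)) (hz' : ∀ w, Function.Injective (z' w)) :
    Subgroup.centralizer ({archDiagTorus L N α z} : Set (arch (↥(maximalRealSubfield L)) L (IsCMField.complexConj L) N (Matrix.diagonal α))) =
      Subgroup.centralizer ({archDiagTorus L N α z'} : Set (arch (↥(maximalRealSubfield L)) L (IsCMField.complexConj L) N (Matrix.diagonal α))) := by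
  rw [centralizer_archDiagTorus_eq_range L N α hα hz, centralizer_archDiagTorus_eq_range L N α hα hz']

/-- Every torus element lies in the centraliser of every torus element (regular or not). [cite: BrockerTomDieck1985, IV (3.1) (p0160)] -/
theorem archDiagTorus_mem_centralizer (z z' : {w : InfinitePlace L // IsComplex w} → Fin N → Circle) :
    archDiagTorus L N α z' ∈
      Subgroup.centralizer ({archDiagTorus L N α z} : Set (arch (↥(maximalRealSubfield L)) L (IsCMField.complexConj L) N (Matrix.diagonal α))) := by
  rw [Subgroup.mem_centralizer_singleton_iff]
  exact archDiagTorus_mul_comm L N α z' z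

end CMCentralizer

end Literature.NumberTheory.Automorphic.UnitaryGroup

end
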